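import Literature.AlgebraicGeometry.Crystalline.HodgeDeRhamDegeneration
import Literature.AlgebraicGeometry.Crystalline.DeRhamComplexVanishing
import Literature.AlgebraicGeometry.Crystalline.GlobalFunctionsDifferential
import HarnessLib

/-!
# Towards `HodgeDeRhamDegeneratesModTorsion`: the settled range and the architecture of the rest

The named fact `Crystalline.HodgeDeRhamDegeneratesModTorsion` (`Crystalline/HodgeDeRhamDegeneration`;
P. Deligne, *Théorème de Lefschetz et critères de dégénérescence de suites spectrales*, Publ. Math.
IHÉS 35 (1968), Thm. 5.5 (ii), transported from the generic fibre) asserts that for a smooth proper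
model `𝒳/W(k)` of relative dimension `d` every connecting homomorphism
`δ : ℍ^{k₀}(𝒳, σ≤n₀ Ω•) → ℍ^{k₀+1}(𝒳, Ωⁿ¹[-n₁])` (`n₀ + 1 = n₁`) of the stupid filtration of the
algebraic de Rham complex has torsion values.

This file holds what is PROVED of it:

* `hodgeDeRhamDegeneratesModTorsion_trivialRange` — **the columns `n₁ ≤ 0` and `n₁ > d`, and the
  degrees `k₁ < n₁`**: for `n₁ ≤ 0` the source `ℍ(σ≤n₀ Ω•)` is zero (`σ≤n₀ Ω• = 0` as `n₀ < 0`); for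
  `n₁ > d` the target is zero since `Ωⁿ¹_{𝒳/W} = 0` (`Crystalline/DeRhamComplexVanishing`: `Ω¹` is
  locally free of rank `d`, Hartshorne II.8.15 / Stacks 02G1, and `⋀ⁿ¹` of it vanishes, Hartshorne
  II Ex. 5.16(a)); for `k₁ < n₁` the target `H^{k₁-n₁}(𝒳, Ωⁿ¹)` sits in negative degree; so `δ = 0`
  and the statement holds with `m = 1`, in exactly the binder shape of the named fact plus the
  range hypothesis (only `IsSmoothProperModel.smoothOfRelativeDimension` is used). What remains is
  the heart `1 ≤ n₁ ≤ d`, `n₁ ≤ k₁` (the vanishing of the target for `k₁ - n₁ > dim 𝒳` by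
  Grothendieck's theorem, `Motives/GrothendieckVanishingProofs`, would need `𝒳` noetherian of
  dimension `d + 1`, which `IsSmoothProperModel` does not record, and is not pursued).

* `hodgeDeRhamDegeneratesModTorsion_cornerZero`, `hodgeDeRhamDegeneratesModTorsion_corner` — **the
  `(0, 0)` corner of the heart** (`n₀ = 0`, `n₁ = 1`, `k₀ = 0`): `δ : H⁰(𝒳, 𝒪) → ℍ^{k₁}(Ω¹[-1])`
  (for `k₁ = 1`: `d : H⁰(𝒪) → H⁰(Ω¹)`) is ZERO, integrally, because global functions on the smooth
  proper `𝒳/W` are integral over the characteristic-`0` domain `W`, hence closed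
  (`Crystalline/GlobalFunctionsDifferential`), through the general lemmas
  `Algebra.Homology.stupidFiltration_delta_zero_eq_zero_of_forall_comp_d_eq_zero`,
  `constantSheaf_hom_comp_eq_zero_of_app_top_eq_zero` and
  `stupidFiltration_delta_eq_zero_of_d_app_top_eq_zero` of this file.

What is NOT proved, and why (recorded for the debt census; nothing below is asserted in Lean): the
columns `1 ≤ n₁ ≤ d` away from the corner `(n₀, k₀) = (0, 0)` are the content of Deligne's theorem.
Its printed proof (loc. cit. §5: Prop. 5.3 for `X/ℂ` by harmonic forms on the compact Kähler
manifold `X^an` and Serre duality;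
Thm. 5.5 by reduction to an artinian local `ℂ`-algebra, the Lefschetz principle, the Poincaré lemma
5.5.3 and GAGA) is transcendental; the algebraic proof (Deligne–Illusie 1987: Cartier isomorphism,
decomposition of `F_*Ω•` from a `W₂`-lifting in dimension `< p`, spreading out to large residue
characteristic) needs coherent finiteness and base change (EGA III §3, §6–7, IV §8). The transport
`W → K = W[1/p]` is cohomology-and-localization for the bounded quasi-coherent complexes `σ≤n Ω•`
on the qcqs scheme `𝒳` (Hartshorne III Prop. 9.3 / EGA III 1.4.15), the generic fibre being the open
subscheme `𝒳[1/p]`. None of these carriers (Hodge theory, GAGA, Cartier, Serre vanishing and Čech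
comparison for quasi-coherent modules, flat base change) exists in Mathlib or in this tree at the
time of writing. [folklore]
-/

noncomputable section

-- As in `Crystalline/HodgeDeRhamDegeneration`: `HasHyperExt` for the truncations is found through
-- `IsStrictlyGE 0 ⇒ IsGE 0` and the shift/localization instances; the default budget is too small.
set_option synthInstance.maxHeartbeats 200000

namespace Literature.AlgebraicGeometry.Crystalline

open CategoryTheory AlgebraicGeometry Limits TopologicalSpace
open Literature.AlgebraicGeometry.Motives Literature.AlgebraicGeometry.Motives.WittScheme
open Literature.Algebra.Homology

set_option maxHeartbeats 400000 in
/-- **`HodgeDeRhamDegeneratesModTorsion` in its trivial range.** For a smooth proper model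
`𝒳/W(k)` of relative dimension `d`, `n₀ + 1 = n₁`, `k₀ + 1 = k₁`, and `n₁ ≤ 0` or `d < n₁` or
`k₁ < n₁`, every connecting homomorphism `δ : ℍ^{k₀}(𝒳, σ≤n₀ Ω•) → ℍ^{k₁}(𝒳, Ωⁿ¹[-n₁])` of the
stupid filtration of the algebraic de Rham complex has torsion values — indeed it is zero: for
`n₁ ≤ 0` its source vanishes (`σ≤n₀ Ω• = 0` as `n₀ < 0`); for `d < n₁` its target does
(`Ωⁿ¹_{𝒳/W} = 0`, `Crystalline.stupidFiltration_delta_eq_zero_of_lt`); for `k₁ < n₁` its target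
`H^{k₁-n₁}(𝒳, Ωⁿ¹)` is in negative degree. Same binders as the named fact
`HodgeDeRhamDegeneratesModTorsion` ([cite: Deligne1968, Thm. 5.5 (ii)]) plus the range hypothesis;
the HEART `1 ≤ n₁ ≤ d`, `n₁ ≤ k₁` (Deligne's theorem proper) is not addressed. [folklore] -/
theorem hodgeDeRhamDegeneratesModTorsion_trivialRange :
    ∀ (p : ℕ) [Fact p.Prime] (k : Type) [Field k] [CharP k p] (d : ℕ)
      (𝒳 : SchemeOver (WittVector p k)), IsSmoothProperModel d 𝒳 →
    ∀ (n₀ n₁ : ℤ) (h : n₀ + 1 = n₁) (k₀ k₁ : ℤ) (hk : k₀ + 1 = k₁), n₁ ≤ 0 ∨ (d : ℤ) < n₁ ∨ k₁ < n₁ →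
      letI K : CochainComplex (Sheaf (Opens.grothendieckTopology 𝒳.left.carrier)
          AddCommGrpCat.{0}) ℤ :=
        (algebraicDeRhamComplex 𝒳).extend ComplexShape.embeddingUpNat
      letI Z : Sheaf (Opens.grothendieckTopology 𝒳.left.carrier) AddCommGrpCat.{0} :=
        (constantSheaf (Opens.grothendieckTopology 𝒳.left.carrier) AddCommGrpCat.{0}).obj
          (AddCommGrpCat.of (ULift.{0} ℤ))
      letI S : ShortComplex (CochainComplex (Sheaf (Opens.grothendieckTopology 𝒳.left.carrier)
          AddCommGrpCat.{0}) ℤ) := stupidFiltrationShortComplex K n₀ n₁ h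
      haveI : (S.X₁).IsStrictlyGE n₁ :=
        (inferInstance : ((CochainComplex.singleFunctor _ n₁).obj (K.X n₁)).IsStrictlyGE n₁)
      haveI : HasHyperExt.{0} Z S.X₁ := hasHyperExt_of_isGE _ _ n₁
      haveI : HasHyperExt.{0} Z S.X₂ := (inferInstance : HasHyperExt.{0} Z (stupidTruncLE K n₁))
      haveI : HasHyperExt.{0} Z S.X₃ := (inferInstance : HasHyperExt.{0} Z (stupidTruncLE K n₀))
      ∀ x : HyperExt.{0} Z S.X₃ k₀,
        ∃ m : ℤ, m ≠ 0 ∧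
          m • HyperExt.delta (shortExact_stupidFiltrationShortComplex K n₀ n₁ h) k₀ k₁ hk x = 0 := by
  intro p _ k _ _ d 𝒳 h𝒳 n₀ n₁ h k₀ k₁ hk hn x
  refine ⟨1, one_ne_zero, ?_⟩
  rw [one_smul]
  rcases hn with hn | hn | hn
  · -- `n₀ < 0`: the source `ℍ(σ≤n₀ Ω•)` is zero, so `x = 0`
    haveI : HasHyperExt.{0} ((constantSheaf (Opens.grothendieckTopology 𝒳.left.carrier)
        AddCommGrpCat.{0}).obj (AddCommGrpCat.of (ULift.{0} ℤ)))
        (stupidFiltrationShortComplex ((algebraicDeRhamComplex 𝒳).extend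
          ComplexShape.embeddingUpNat) n₀ n₁ h).X₃ :=
      (inferInstance : HasHyperExt.{0} _
        (stupidTruncLE ((algebraicDeRhamComplex 𝒳).extend ComplexShape.embeddingUpNat) n₀))
    have hx : x = 0 :=
      HyperExt.eq_zero_of_isZero (isZero_stupidTruncLE
        ((algebraicDeRhamComplex 𝒳).extend ComplexShape.embeddingUpNat) n₀ 0 (by omega)) x
    rw [hx, map_zero]
  · -- `d < n₁`: the target `ℍ(Ωⁿ¹[-n₁])` is zero
    haveI := h𝒳.smoothOfRelativeDimension
    exact stupidFiltration_delta_eq_zero_of_lt 𝒳 d _ n₀ n₁ h hn k₀ k₁ hk x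
  · -- `k₁ < n₁`: the target `ℍ^{k₁}(Ωⁿ¹[-n₁]) = H^{k₁-n₁}(Ωⁿ¹)` is in negative degree
    haveI : ((stupidFiltrationShortComplex ((algebraicDeRhamComplex 𝒳).extend
        ComplexShape.embeddingUpNat) n₀ n₁ h).X₁).IsStrictlyGE n₁ :=
      (inferInstance : ((CochainComplex.singleFunctor _ n₁).obj
        (((algebraicDeRhamComplex 𝒳).extend ComplexShape.embeddingUpNat).X n₁)).IsStrictlyGE n₁)
    haveI : HasHyperExt.{0} ((constantSheaf (Opens.grothendieckTopology 𝒳.left.carrier)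
        AddCommGrpCat.{0}).obj (AddCommGrpCat.of (ULift.{0} ℤ)))
        (stupidFiltrationShortComplex ((algebraicDeRhamComplex 𝒳).extend
          ComplexShape.embeddingUpNat) n₀ n₁ h).X₁ :=
      hasHyperExt_of_isGE _ _ n₁
    exact HyperExt.eq_zero_of_isGE n₁ hn _

/-- **Reduction of `HodgeDeRhamDegeneratesModTorsion` to its heart.** The named fact
`HodgeDeRhamDegeneratesModTorsion` (Deligne 1968, Thm. 5.5 (ii), every connecting homomorphism of the
stupid filtration of `Ω•_{𝒳/W}` has torsion values in hypercohomology) follows from its restriction to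
the HEART range `0 < n₁ ≤ d`, `n₁ ≤ k₁` (the columns `Ω¹, …, Ωᵈ` in non-negative cohomological degree
`k₁ - n₁`): outside that range the connecting homomorphism is zero
(`hodgeDeRhamDegeneratesModTorsion_trivialRange`). The hypothesis `heart` has exactly the binders of
the named fact plus the three range hypotheses, so a proof of Deligne's theorem in the heart range
discharges the fact by `hodgeDeRhamDegeneratesModTorsion_of_heart thatProof`. Elementary case split;
nothing of Deligne's theorem is proved here. [folklore] -/
theorem hodgeDeRhamDegeneratesModTorsion_of_heart
    (heart : ∀ (p : ℕ) [Fact p.Prime] (k : Type) [Field k] [CharP k p] (d : ℕ)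
      (𝒳 : SchemeOver (WittVector p k)), IsSmoothProperModel d 𝒳 →
      ∀ (n₀ n₁ : ℤ) (h : n₀ + 1 = n₁) (k₀ k₁ : ℤ) (hk : k₀ + 1 = k₁),
        0 < n₁ → n₁ ≤ (d : ℤ) → n₁ ≤ k₁ →
      letI K : CochainComplex (Sheaf (Opens.grothendieckTopology 𝒳.left.carrier)
          AddCommGrpCat.{0}) ℤ :=
        (algebraicDeRhamComplex 𝒳).extend ComplexShape.embeddingUpNat
      letI Z : Sheaf (Opens.grothendieckTopology 𝒳.left.carrier) AddCommGrpCat.{0} :=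
        (constantSheaf (Opens.grothendieckTopology 𝒳.left.carrier) AddCommGrpCat.{0}).obj
          (AddCommGrpCat.of (ULift.{0} ℤ))
      letI S : ShortComplex (CochainComplex (Sheaf (Opens.grothendieckTopology 𝒳.left.carrier)
          AddCommGrpCat.{0}) ℤ) := stupidFiltrationShortComplex K n₀ n₁ h
      haveI : (S.X₁).IsStrictlyGE n₁ :=
        (inferInstance : ((CochainComplex.singleFunctor _ n₁).obj (K.X n₁)).IsStrictlyGE n₁)
      haveI : HasHyperExt.{0} Z S.X₁ := hasHyperExt_of_isGE _ _ n₁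
      haveI : HasHyperExt.{0} Z S.X₂ := (inferInstance : HasHyperExt.{0} Z (stupidTruncLE K n₁))
      haveI : HasHyperExt.{0} Z S.X₃ := (inferInstance : HasHyperExt.{0} Z (stupidTruncLE K n₀))
      ∀ x : HyperExt.{0} Z S.X₃ k₀,
        ∃ m : ℤ, m ≠ 0 ∧
          m • HyperExt.delta (shortExact_stupidFiltrationShortComplex K n₀ n₁ h) k₀ k₁ hk x = 0) :
    HodgeDeRhamDegeneratesModTorsion := by
  intro p _ k _ _ d 𝒳 h𝒳 n₀ n₁ h k₀ k₁ hk x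
  by_cases hn : n₁ ≤ 0 ∨ (d : ℤ) < n₁ ∨ k₁ < n₁
  · exact hodgeDeRhamDegeneratesModTorsion_trivialRange p k d 𝒳 h𝒳 n₀ n₁ h k₀ k₁ hk hn x
  · simp only [not_or, not_le, not_lt] at hn
    exact heart p k d 𝒳 h𝒳 n₀ n₁ h k₀ k₁ hk hn.1 hn.2.1 hn.2.2 x

/-! ### The `(0, 0)` corner of the heart: `δ = 0` on `ℍ⁰(σ≤0 Ω•)` when `d⁰` kills global sections

Three general lemmas (the first in `Literature.Algebra.Homology`), then their combination: for any
`k`-scheme `X` such that the degree-`0` differential `𝒪_X = Ω⁰ →ᵈ Ω¹` of the algebraic de Rham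
complex kills every GLOBAL section, the connecting homomorphism
`δ : ℍ⁰(X, σ≤0 Ω•) → ℍ¹(X, Ω¹[-1]) = H⁰(X, Ω¹)` of the stupid filtration vanishes. The hypothesis is
supplied, for `𝒳/W(k)` smooth and proper, by `Crystalline/GlobalFunctionsDifferential`
(`algebraicDeRhamComplex_d_app_top_eq_zero`: global functions are integral over `W`, hence closed).
-/

end Literature.AlgebraicGeometry.Crystalline

namespace Literature.Algebra.Homology

open CategoryTheory Limits CochainComplex

universe w' v' u'

variable {C : Type u'} [Category.{v'} C] [Abelian C]

-- `singleFunctor C n` is `HomologicalComplex.single _ _ n` only up to unfolding.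
set_option backward.isDefEq.respectTransparency false in
/-- For `K` strictly concentrated in degrees `≥ n`, the inclusion `Kⁿ[-n] ⟶ σ≤n K`
(`singleToStupidTruncLE`) is an isomorphism: an isomorphism in degree `n`, and zero objects on both
sides elsewhere. [folklore] -/
theorem isIso_singleToStupidTruncLE (K : CochainComplex C ℤ) (n : ℤ) [K.IsStrictlyGE n] :
    IsIso (singleToStupidTruncLE K n) := by
  haveI : ∀ i, IsIso ((singleToStupidTruncLE K n).f i) := fun i => by
    by_cases hi : i = n
    · subst hi
      infer_instance
    · refine ⟨0, (HomologicalComplex.isZero_single_obj_X (ComplexShape.up ℤ) n (K.X n) i hi).eq_of_src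
        _ _, ?_⟩
      rcases lt_or_gt_of_ne hi with hlt | hgt
      · exact ((K.isZero_of_isStrictlyGE n i hlt).of_iso
          (stupidTruncLEXIso K n i hlt.le)).eq_of_src _ _
      · exact (isZero_stupidTruncLE_X K n i hgt).eq_of_src _ _
  exact HomologicalComplex.Hom.isIso_of_components _

set_option backward.isDefEq.respectTransparency false in
/-- **The first connecting map of the stupid filtration vanishes when `d⁰` kills every map from
`X`.** Let `K` be a cochain complex strictly concentrated in degrees `≥ 0` and `X` an object with
`φ ≫ d⁰ = 0` for every `φ : X ⟶ K⁰`. Then the connecting homomorphism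
`δ : HyperExt X (σ≤0 K) 0 → HyperExt X (K¹[-1]) k₁` of `0 → K¹[-1] → σ≤1 K → σ≤0 K → 0`
(`shortExact_stupidFiltrationShortComplex`) is zero: a class `x` is `[φ]` for the morphism
`φ : X ⟶ K⁰` it determines (`σ≤0 K ≅ K⁰[0]`, `Ext⁰ = Hom`: `isIso_singleToStupidTruncLE`,
`HyperExt.extEquiv_comp_mk₀`), and `φ`, a cocycle, lifts to a chain map `X[0] ⟶ σ≤1 K`
(`HomologicalComplex.mkHomFromSingle`), so `x` comes from `HyperExt X (σ≤1 K) 0` and dies under `δ`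
(`HyperExt.delta_map_eq_zero`). The `HasHyperExt` hypotheses are those carried by a goal
`δ x = 0` in the `stupidFiltrationShortComplex` spelling (`X₁`, `X₃` implicit, `X₂` explicit).
[cite: Weibel1994, Example 10.4.9 and Def. 10.7.1] -/
theorem stupidFiltration_delta_zero_eq_zero_of_forall_comp_d_eq_zero [HasExt.{w'} C] (X : C)
    (K : CochainComplex C ℤ) [K.IsStrictlyGE 0] (hd : ∀ φ : X ⟶ K.X 0, φ ≫ K.d 0 1 = 0)
    (h01 : (0 : ℤ) + 1 = 1) (k₁ : ℤ) (hk : (0 : ℤ) + 1 = k₁)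
    {_ : HasHyperExt.{w'} X (stupidFiltrationShortComplex K 0 1 h01).X₁}
    (h₂ : HasHyperExt.{w'} X (stupidFiltrationShortComplex K 0 1 h01).X₂)
    {h₃ : HasHyperExt.{w'} X (stupidFiltrationShortComplex K 0 1 h01).X₃}
    (x : HyperExt.{w'} X (stupidFiltrationShortComplex K 0 1 h01).X₃ 0) :
    HyperExt.delta (shortExact_stupidFiltrationShortComplex K 0 1 h01) 0 k₁ hk x = 0 := by
  haveI : HasHyperExt.{w'} X (stupidTruncLE K 0) := h₃
  haveI : HasHyperExt.{w'} X (stupidTruncLE K 1) := h₂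
  haveI := isIso_singleToStupidTruncLE K 0
  -- (1) `x` is the image of a class of `K⁰[0]` under the isomorphism `K⁰[0] ≅ σ≤0 K`
  set x' : HyperExt.{w'} X ((singleFunctor C 0).obj (K.X 0)) 0 :=
    HyperExt.map (inv (singleToStupidTruncLE K 0)) 0 x with hx'def
  have hx : x = HyperExt.map (singleToStupidTruncLE K 0) 0 x' := by
    rw [hx'def, ← HyperExt.map_comp, IsIso.inv_hom_id, HyperExt.map_id]
  -- (2) `x' = [φ]` for the morphism `φ : X ⟶ K⁰` it determines
  obtain ⟨φ, hφ⟩ : ∃ φ : X ⟶ K.X 0, x' = HyperExt.map ((singleFunctor C 0).map φ) 0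
      (HyperExt.extEquiv X X 0 (Abelian.Ext.mk₀ (𝟙 X))) := by
    refine ⟨Abelian.Ext.homEquiv₀ ((HyperExt.extEquiv X (K.X 0) 0).symm x'), ?_⟩
    change x' = HyperExt.map ((singleFunctor C 0).map _) ((0 : ℕ) : ℤ)
      (HyperExt.extEquiv X X 0 (Abelian.Ext.mk₀ (𝟙 X)))
    rw [← HyperExt.extEquiv_comp_mk₀, Abelian.Ext.mk₀_comp_mk₀, Category.id_comp,
      Abelian.Ext.mk₀_homEquiv₀_apply, AddEquiv.apply_symm_apply]
  -- (3) `φ` is a cocycle, hence lifts to a chain map `X[0] ⟶ σ≤1 K`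
  let ψ : (singleFunctor C 0).obj X ⟶ stupidTruncLE K 1 :=
    HomologicalComplex.mkHomFromSingle (φ ≫ (stupidTruncLEXIso K 1 0 zero_le_one).inv) (by
      intro j hj
      have hj1 : j = 1 := by change (0 : ℤ) + 1 = j at hj; omega
      subst hj1
      rw [stupidTruncLE_d_eq K 1 0 1 zero_le_one le_rfl, Category.assoc, Iso.inv_hom_id_assoc,
        ← Category.assoc, hd φ, zero_comp])
  have hψ : ψ ≫ (stupidFiltrationShortComplex K 0 1 h01).g =
      (singleFunctor C 0).map φ ≫ singleToStupidTruncLE K 0 := by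
    apply HomologicalComplex.from_single_hom_ext
    simp [ψ, CochainComplex.singleFunctor, CochainComplex.singleFunctors,
      HomologicalComplex.single_map_f_self, HomologicalComplex.mkHomFromSingle_f,
      stupidTruncLEMapOfLE_f_eq K 0 1 (by omega) 0 le_rfl]
  -- (4) so `x` comes from `HyperExt X (σ≤1 K) 0`, and `δ` kills it
  rw [hx, hφ, ← HyperExt.map_comp, ← hψ, HyperExt.map_comp]
  exact HyperExt.delta_map_eq_zero _ 0 k₁ hk _

end Literature.Algebra.Homology

namespace Literature.AlgebraicGeometry.Crystalline

open CategoryTheory _root_.AlgebraicGeometry Limits TopologicalSpace Opposite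
open Literature.AlgebraicGeometry.Motives Literature.AlgebraicGeometry.Motives.WittScheme
open Literature.Algebra.Homology

universe u

/-- **Morphisms out of a constant sheaf are killed by a morphism that kills global sections.** On
the site of opens of a topological space, for abelian sheaves `F`, `G`, a morphism `g : F ⟶ G` with
`g(⊤) = 0` and any morphism `φ` from the constant sheaf with value `A`, `φ ≫ g = 0`: a morphism out
of `A^{sh}` is determined by its precomposition with `A → A^{sh}` (`sheafify_hom_ext`), a natural
transformation out of the constant PRESHEAF is determined by its component at `⊤` (restrict along
`U ⊆ ⊤`), and that component factors through `g(⊤) = 0`. [folklore] -/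
theorem constantSheaf_hom_comp_eq_zero_of_app_top_eq_zero {T : Type u} [TopologicalSpace T]
    (A : AddCommGrpCat.{u}) {F G : Sheaf (Opens.grothendieckTopology T) AddCommGrpCat.{u}}
    (g : F ⟶ G) (hg : g.hom.app (op ⊤) = 0)
    (φ : (constantSheaf (Opens.grothendieckTopology T) AddCommGrpCat.{u}).obj A ⟶ F) :
    φ ≫ g = 0 := by
  refine Sheaf.hom_ext (sheafify_hom_ext (J := Opens.grothendieckTopology T)
    (P := (Functor.const (Opens T)ᵒᵖ).obj A) _ _ G.property ?_)
  change toSheafify _ ((Functor.const (Opens T)ᵒᵖ).obj A) ≫ φ.hom ≫ g.hom =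
    toSheafify _ ((Functor.const (Opens T)ᵒᵖ).obj A) ≫ 0
  rw [comp_zero]
  ext ⟨U⟩ : 2
  have hnat := (toSheafify (Opens.grothendieckTopology T) ((Functor.const (Opens T)ᵒᵖ).obj A) ≫
    φ.hom ≫ g.hom).naturality (homOfLE (le_top : U ≤ ⊤)).op
  rw [Functor.const_obj_map] at hnat
  erw [Category.id_comp] at hnat
  rw [NatTrans.app_zero, hnat, NatTrans.comp_app, NatTrans.comp_app, hg]
  erw [comp_zero, zero_comp]
  rfl

section Corner

-- `HasHyperExt` for the truncations of the `ℤ`-extended de Rham complex, as in the statement of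
-- the named fact.
variable {k : Type u} [CommRing k] (X : SchemeOver k)

/-- **The `(0, 0)` corner of Hodge–de Rham degeneration, from the vanishing of `d` on global
functions.** For a `k`-scheme `X` such that the degree-`0` differential of the algebraic de Rham
complex kills every global section of `Ω⁰ = (𝒪_X)^{sh}`, the connecting homomorphism
`δ : ℍ⁰(X, σ≤0 Ω•) → ℍ^{k₁}(X, Ω¹[-1])` (`0 + 1 = k₁`; hyper-Ext from any abelian sheaf `A`, e.g. the
constant sheaf `ℤ`: hypercohomology) of `0 → Ω¹[-1] → σ≤1 Ω• → σ≤0 Ω• → 0` is ZERO, where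
`Ω• = (algebraicDeRhamComplex X).extend embeddingUpNat`. Combination of
`constantSheaf_hom_comp_eq_zero_of_app_top_eq_zero` (every `A^{sh} = ℤ ⟶ Ω⁰` is killed by `d⁰`,
read through `HomologicalComplex.extendXIso`) and
`Algebra.Homology.stupidFiltration_delta_zero_eq_zero_of_forall_comp_d_eq_zero`. Binder shape: the
indices `n₀, n₁, k₀` as variables with the corner equations `n₀ = 0`, `k₀ = 0` (substituted here,
where the goal is small, rather than in the `letI`-laden statement of the named fact), the two
`HasHyperExt` hypotheses of `HyperExt.delta` implicit, that of the middle term explicit, all in the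
`stupidFiltrationShortComplex` spelling of the named fact `HodgeDeRhamDegeneratesModTorsion`.
[folklore] -/
theorem stupidFiltration_delta_eq_zero_of_d_app_top_eq_zero (A : AddCommGrpCat.{u})
    (hd0 : ∀ s : ((algebraicDeRhamComplex X).X 0).obj.obj (op ⊤),
      ((algebraicDeRhamComplex X).d 0 1).hom.app (op ⊤) s = 0)
    (n₀ n₁ : ℤ) (h : n₀ + 1 = n₁) (hn₀ : n₀ = 0) (k₀ k₁ : ℤ) (hk : k₀ + 1 = k₁) (hk₀ : k₀ = 0)
    {_ : HasHyperExt.{u} ((constantSheaf (Opens.grothendieckTopology X.left) AddCommGrpCat.{u}).obj A)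
      (stupidFiltrationShortComplex
        ((algebraicDeRhamComplex X).extend ComplexShape.embeddingUpNat) n₀ n₁ h).X₁}
    (h₂ : HasHyperExt.{u} ((constantSheaf (Opens.grothendieckTopology X.left) AddCommGrpCat.{u}).obj A)
      (stupidFiltrationShortComplex
        ((algebraicDeRhamComplex X).extend ComplexShape.embeddingUpNat) n₀ n₁ h).X₂)
    {_ : HasHyperExt.{u} ((constantSheaf (Opens.grothendieckTopology X.left) AddCommGrpCat.{u}).obj A)
      (stupidFiltrationShortComplex
        ((algebraicDeRhamComplex X).extend ComplexShape.embeddingUpNat) n₀ n₁ h).X₃}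
    (x : HyperExt.{u} ((constantSheaf (Opens.grothendieckTopology X.left) AddCommGrpCat.{u}).obj A)
      (stupidFiltrationShortComplex
        ((algebraicDeRhamComplex X).extend ComplexShape.embeddingUpNat) n₀ n₁ h).X₃ k₀) :
    HyperExt.delta (shortExact_stupidFiltrationShortComplex
      ((algebraicDeRhamComplex X).extend ComplexShape.embeddingUpNat) n₀ n₁ h) k₀ k₁ hk x = 0 := by
  subst hn₀
  subst hk₀
  obtain rfl : n₁ = 1 := by omega
  refine stupidFiltration_delta_zero_eq_zero_of_forall_comp_d_eq_zero _ _ (fun φ => ?_) h k₁ hk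
    h₂ x
  -- `φ ≫ d = 0` for every `φ : A^{sh} ⟶ (Ω•ext)⁰ ≅ Ω⁰`, since `d⁰` kills global sections
  have hg : ((algebraicDeRhamComplex X).d 0 1).hom.app (op ⊤) = 0 := by
    ext s
    exact hd0 s
  rw [(algebraicDeRhamComplex X).extend_d_eq ComplexShape.embeddingUpNat
      (show ComplexShape.embeddingUpNat.f 0 = (0 : ℤ) from rfl)
      (show ComplexShape.embeddingUpNat.f 1 = (1 : ℤ) from rfl),
    ← Category.assoc, ← Category.assoc, constantSheaf_hom_comp_eq_zero_of_app_top_eq_zero A _ hg,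
    zero_comp]

/-- **The `(0, 0)` corner of `HodgeDeRhamDegeneratesModTorsion`, integrally.** For a smooth proper
model `𝒳/W(k)` of relative dimension `d`, the connecting homomorphism
`δ : ℍ⁰(𝒳, σ≤0 Ω•) = H⁰(𝒳, 𝒪) → ℍ^{k₁}(𝒳, Ω¹[-1])` (`0 + 1 = k₁`; for `k₁ = 1` this is
`d : H⁰(𝒳, 𝒪_𝒳) → H⁰(𝒳, Ω¹_{𝒳/W})`, the differential `E₁^{0,0} → E₁^{1,0}` of the Hodge–de Rham
spectral sequence) is ZERO — not merely torsion: global functions on `𝒳` are integral over `W`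
(`𝒳 → Spec W` is universally closed) and `W` is a domain of characteristic `0`, so their
differentials vanish
(`Crystalline/GlobalFunctionsDifferential.algebraicDeRhamComplex_d_app_top_eq_zero`),
hence every `ℤ ⟶ Ω⁰` is killed by `d⁰` and `δ` vanishes on `ℍ⁰(σ≤0 Ω•)`
(`stupidFiltration_delta_eq_zero_of_d_app_top_eq_zero`). Binders: those of the named fact
`HodgeDeRhamDegeneratesModTorsion` ([cite: Deligne1968, Thm. 5.5 (ii)]) with `n₀ = 0`, `n₁ = 1`,
`k₀ = 0`. This is the first entry of the HEART of that fact (`1 ≤ n₁ ≤ d`, `n₁ ≤ k₁`) to be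
proved; the entries `(a, b) → (a + 1, b)` with `a ≥ 1` or `b ≥ 1` are Deligne's theorem proper
and remain open here. [folklore] -/
theorem hodgeDeRhamDegeneratesModTorsion_cornerZero :
    ∀ (p : ℕ) [Fact p.Prime] (k : Type) [Field k] [CharP k p] (d : ℕ)
      (𝒳 : SchemeOver (WittVector p k)), IsSmoothProperModel d 𝒳 →
    ∀ (h : (0 : ℤ) + 1 = 1) (k₁ : ℤ) (hk : (0 : ℤ) + 1 = k₁),
      letI K : CochainComplex (Sheaf (Opens.grothendieckTopology 𝒳.left.carrier)
          AddCommGrpCat.{0}) ℤ :=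
        (algebraicDeRhamComplex 𝒳).extend ComplexShape.embeddingUpNat
      letI Z : Sheaf (Opens.grothendieckTopology 𝒳.left.carrier) AddCommGrpCat.{0} :=
        (constantSheaf (Opens.grothendieckTopology 𝒳.left.carrier) AddCommGrpCat.{0}).obj
          (AddCommGrpCat.of (ULift.{0} ℤ))
      letI S : ShortComplex (CochainComplex (Sheaf (Opens.grothendieckTopology 𝒳.left.carrier)
          AddCommGrpCat.{0}) ℤ) := stupidFiltrationShortComplex K 0 1 h
      haveI : (S.X₁).IsStrictlyGE 1 :=
        (inferInstance : ((CochainComplex.singleFunctor _ 1).obj (K.X 1)).IsStrictlyGE 1)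
      haveI : HasHyperExt.{0} Z S.X₁ := hasHyperExt_of_isGE _ _ 1
      haveI : HasHyperExt.{0} Z S.X₂ := (inferInstance : HasHyperExt.{0} Z (stupidTruncLE K 1))
      haveI : HasHyperExt.{0} Z S.X₃ := (inferInstance : HasHyperExt.{0} Z (stupidTruncLE K 0))
      ∀ x : HyperExt.{0} Z S.X₃ 0,
        HyperExt.delta (shortExact_stupidFiltrationShortComplex K 0 1 h) 0 k₁ hk x = 0 := by
  intro p _ k _ _ d 𝒳 h𝒳 h k₁ hk x
  haveI := h𝒳.smoothOfRelativeDimension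
  haveI : IsProper 𝒳.hom := h𝒳.isProper
  have h₂ : HasHyperExt.{0} ((constantSheaf (Opens.grothendieckTopology 𝒳.left.carrier)
      AddCommGrpCat.{0}).obj (AddCommGrpCat.of (ULift.{0} ℤ)))
      (stupidFiltrationShortComplex ((algebraicDeRhamComplex 𝒳).extend
        ComplexShape.embeddingUpNat) 0 1 h).X₂ :=
    (inferInstance : HasHyperExt.{0} _
      (stupidTruncLE ((algebraicDeRhamComplex 𝒳).extend ComplexShape.embeddingUpNat) 1))
  exact stupidFiltration_delta_eq_zero_of_d_app_top_eq_zero 𝒳 (AddCommGrpCat.of (ULift.{0} ℤ))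
    (algebraicDeRhamComplex_d_app_top_eq_zero 𝒳 d) 0 1 h rfl 0 k₁ hk rfl h₂ x

/-- **`HodgeDeRhamDegeneratesModTorsion` at its `(0, 0)` corner**, in the exact binder shape of the
named fact plus the two corner hypotheses `n₀ = 0`, `k₀ = 0` (so `n₁ = 1`): the connecting
homomorphism has torsion values — indeed it is zero (`hodgeDeRhamDegeneratesModTorsion_cornerZero`),
so `m = 1` works. Together with `hodgeDeRhamDegeneratesModTorsion_trivialRange` this settles the
named fact ([cite: Deligne1968, Thm. 5.5 (ii)]) outside the range `1 ≤ n₁ ≤ d`, `n₁ ≤ k₁`,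
`(n₀, k₀) ≠ (0, 0)`. [folklore] -/
theorem hodgeDeRhamDegeneratesModTorsion_corner :
    ∀ (p : ℕ) [Fact p.Prime] (k : Type) [Field k] [CharP k p] (d : ℕ)
      (𝒳 : SchemeOver (WittVector p k)), IsSmoothProperModel d 𝒳 →
    ∀ (n₀ n₁ : ℤ) (h : n₀ + 1 = n₁) (k₀ k₁ : ℤ) (hk : k₀ + 1 = k₁), n₀ = 0 → k₀ = 0 →
      letI K : CochainComplex (Sheaf (Opens.grothendieckTopology 𝒳.left.carrier)
          AddCommGrpCat.{0}) ℤ :=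
        (algebraicDeRhamComplex 𝒳).extend ComplexShape.embeddingUpNat
      letI Z : Sheaf (Opens.grothendieckTopology 𝒳.left.carrier) AddCommGrpCat.{0} :=
        (constantSheaf (Opens.grothendieckTopology 𝒳.left.carrier) AddCommGrpCat.{0}).obj
          (AddCommGrpCat.of (ULift.{0} ℤ))
      letI S : ShortComplex (CochainComplex (Sheaf (Opens.grothendieckTopology 𝒳.left.carrier)
          AddCommGrpCat.{0}) ℤ) := stupidFiltrationShortComplex K n₀ n₁ h
      haveI : (S.X₁).IsStrictlyGE n₁ :=
        (inferInstance : ((CochainComplex.singleFunctor _ n₁).obj (K.X n₁)).IsStrictlyGE n₁)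
      haveI : HasHyperExt.{0} Z S.X₁ := hasHyperExt_of_isGE _ _ n₁
      haveI : HasHyperExt.{0} Z S.X₂ := (inferInstance : HasHyperExt.{0} Z (stupidTruncLE K n₁))
      haveI : HasHyperExt.{0} Z S.X₃ := (inferInstance : HasHyperExt.{0} Z (stupidTruncLE K n₀))
      ∀ x : HyperExt.{0} Z S.X₃ k₀,
        ∃ m : ℤ, m ≠ 0 ∧
          m • HyperExt.delta (shortExact_stupidFiltrationShortComplex K n₀ n₁ h) k₀ k₁ hk x = 0 := by
  intro p _ k _ _ d 𝒳 h𝒳 n₀ n₁ h k₀ k₁ hk hn₀ hk₀ x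
  refine ⟨1, one_ne_zero, ?_⟩
  rw [one_smul]
  haveI := h𝒳.smoothOfRelativeDimension
  haveI : IsProper 𝒳.hom := h𝒳.isProper
  have h₂ : HasHyperExt.{0} ((constantSheaf (Opens.grothendieckTopology 𝒳.left.carrier)
      AddCommGrpCat.{0}).obj (AddCommGrpCat.of (ULift.{0} ℤ)))
      (stupidFiltrationShortComplex ((algebraicDeRhamComplex 𝒳).extend
        ComplexShape.embeddingUpNat) n₀ n₁ h).X₂ :=
    (inferInstance : HasHyperExt.{0} _
      (stupidTruncLE ((algebraicDeRhamComplex 𝒳).extend ComplexShape.embeddingUpNat) n₁))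
  exact stupidFiltration_delta_eq_zero_of_d_app_top_eq_zero 𝒳 (AddCommGrpCat.of (ULift.{0} ℤ))
    (algebraicDeRhamComplex_d_app_top_eq_zero 𝒳 d) n₀ n₁ h hn₀ k₀ k₁ hk hk₀ h₂ x

/-- **Reduction of `HodgeDeRhamDegeneratesModTorsion` to its heart minus the corner.** As
`hodgeDeRhamDegeneratesModTorsion_of_heart`, but the hypothesis is only required OFF the corner
`(n₀, k₀) = (0, 0)`, which is settled by `hodgeDeRhamDegeneratesModTorsion_corner`: a proof of
Deligne's theorem ([cite: Deligne1968, Thm. 5.5 (ii)]) for `1 ≤ n₁ ≤ d`, `n₁ ≤ k₁`,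
`(n₀, k₀) ≠ (0, 0)` — the `E₁`-differentials `H^b(Ωᵃ) → H^b(Ωᵃ⁺¹)` modulo torsion for
`(a, b) ≠ (0, 0)` — discharges the named fact. Elementary case split. [folklore] -/
theorem hodgeDeRhamDegeneratesModTorsion_of_heart_off_corner
    (heart : ∀ (p : ℕ) [Fact p.Prime] (k : Type) [Field k] [CharP k p] (d : ℕ)
      (𝒳 : SchemeOver (WittVector p k)), IsSmoothProperModel d 𝒳 →
      ∀ (n₀ n₁ : ℤ) (h : n₀ + 1 = n₁) (k₀ k₁ : ℤ) (hk : k₀ + 1 = k₁),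
        0 < n₁ → n₁ ≤ (d : ℤ) → n₁ ≤ k₁ → ¬ (n₀ = 0 ∧ k₀ = 0) →
      letI K : CochainComplex (Sheaf (Opens.grothendieckTopology 𝒳.left.carrier)
          AddCommGrpCat.{0}) ℤ :=
        (algebraicDeRhamComplex 𝒳).extend ComplexShape.embeddingUpNat
      letI Z : Sheaf (Opens.grothendieckTopology 𝒳.left.carrier) AddCommGrpCat.{0} :=
        (constantSheaf (Opens.grothendieckTopology 𝒳.left.carrier) AddCommGrpCat.{0}).obj
          (AddCommGrpCat.of (ULift.{0} ℤ))
      letI S : ShortComplex (CochainComplex (Sheaf (Opens.grothendieckTopology 𝒳.left.carrier)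
          AddCommGrpCat.{0}) ℤ) := stupidFiltrationShortComplex K n₀ n₁ h
      haveI : (S.X₁).IsStrictlyGE n₁ :=
        (inferInstance : ((CochainComplex.singleFunctor _ n₁).obj (K.X n₁)).IsStrictlyGE n₁)
      haveI : HasHyperExt.{0} Z S.X₁ := hasHyperExt_of_isGE _ _ n₁
      haveI : HasHyperExt.{0} Z S.X₂ := (inferInstance : HasHyperExt.{0} Z (stupidTruncLE K n₁))
      haveI : HasHyperExt.{0} Z S.X₃ := (inferInstance : HasHyperExt.{0} Z (stupidTruncLE K n₀))
      ∀ x : HyperExt.{0} Z S.X₃ k₀,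
        ∃ m : ℤ, m ≠ 0 ∧
          m • HyperExt.delta (shortExact_stupidFiltrationShortComplex K n₀ n₁ h) k₀ k₁ hk x = 0) :
    HodgeDeRhamDegeneratesModTorsion := by
  intro p _ k _ _ d 𝒳 h𝒳 n₀ n₁ h k₀ k₁ hk x
  by_cases hn : n₁ ≤ 0 ∨ (d : ℤ) < n₁ ∨ k₁ < n₁
  · exact hodgeDeRhamDegeneratesModTorsion_trivialRange p k d 𝒳 h𝒳 n₀ n₁ h k₀ k₁ hk hn x
  · simp only [not_or, not_le, not_lt] at hn
    by_cases hc : n₀ = 0 ∧ k₀ = 0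
    · exact hodgeDeRhamDegeneratesModTorsion_corner p k d 𝒳 h𝒳 n₀ n₁ h k₀ k₁ hk hc.1 hc.2 x
    · exact heart p k d 𝒳 h𝒳 n₀ n₁ h k₀ k₁ hk hn.1 hn.2.1 hn.2.2 hc x

end Corner


end Literature.AlgebraicGeometry.Crystalline

end
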